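import Mathlib
import Summits.QuantumFields.YangMills.Theorems.BalabanUVNodesN15BackgroundPropagator
import Summits.QuantumFields.YangMills.Theorems.BalabanUVNodesN15OperatorReadout
import Literature.MathematicalPhysics.QuantumFieldTheory.Balaban1983to89.B9SectDSup
import HarnessLib

/-!
# Route «BalabanUVNodes» (cluster K4 «SpineRates»), Track-A DAG node N15 = spine estimate NE2, BACKGROUND LAYER — THE NODE'S FIRST CONJUNCT
# `T4EtaRate.NE2PlusOperator` BY NAME WITH THE BACKGROUND BLOCK LIVE: a background CARRIER whose `Reg335` IS the (3.35) letter pair, realised paired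
# instances with the datum's OWN [B9] size parameter `M`, the per-index `EtaRateIneq342` with explicit constants, and the uniform readout

Cell `pub-ymgap`, seat `pub-ymgap-dag-n15-b` (generation g5; FIRST-MISSING-ESTIMATE, HUMAN RULING D-0062; chair R424 venue; ROSTER-D0062 l.26).
`bears_on: R4∕N15`.  Filed `--supports stmt-QuantumFields-19351` (helper).  Imports part A1 `…N15.BackgroundLayer` (`bgProp`, `hasMaj_idef_bgProp`) and g0's
`…N15.OperatorReadout` (`opGeo`, `opFamily`, `etaRateIneq342_of_hasMaj`, `rateFactor_opGeo`), `B9SectDSup.inv_one_sub_le_two` BY NAME; nothing in the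
tree is modified.

THE LOCATED GAP THIS CLOSES (ref-B READ #323 ∕ #335, INBOX l.11794).  Every by-name `NE2PlusOperator` in the tree is stated at the one-point background
carrier `pt9Bg` — *«the «+» block is inert»* (g0 knit; -a parts 17∕23) — and on realised geometries with `M ≡ 1`, where the printed guard «`M₅ ≤ M`» VOIDS
the statement (*«A2-VACUOUS-AS-TYPED»*).  Here: (i) the background carrier `coeffBg π M θ` has configurations = fine coefficient fields `c′ : X′ → ℝ`
(the zeroth-order perturbation species `V′ = M_{c′}` of [B9] (3.50)–(3.53)), `one := 0` (`U ≡ 1 ⟺ A = 0`), and `Reg335 c α₀ c′ :=` THE (3.35) LETTER PAIR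
read blockwise — sup letter `|c′| ≤ c·M·α₀` and within-block oscillation letter `FibreOsc π c′ (c·M·α₀·θ)` (p. 396: *«|A| < O(1)Mα₀(L^jη)^{−1}, |∇^ηA| <
O(1)Mα₀(L^jη)^{−2} on □, where O(1)M is a size of □»*; `θ` = the instance's rate number, the oscillation over a block of a field with the printed gradient
bound being one rate factor smaller than its sup — parts 12a∕12d); (ii) the paired instances carry the datum's OWN size parameter `M` (`bgInstance_M`), so
the guard `M₅ ≤ M` is LIVE whenever the consumer's family has unbounded `M`, and the printed smallness `M·α₀ ≤ a₀` is EXACTLY what makes the fine Neumann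
step contract (`q = β·(c₃₅a₀)·c_r ≤ ½`); (iii) the background transport is the block average (`T4EtaRate.EtaPairing.avg := blockAvg π`, linearised (C3));
(iv) entry 0 of the kernel family is the η-difference of the CONSTRUCTED pair `𝔇(bgProp G′ c′, bgProp G (blockAvg π c′))` (part A1), entries 1–3 are the
consumer's operators `T n c′` with (3.42)-shaped majorant hypotheses (displayed binders, exactly as -a part 17's `T3`; their derivation from the `U ≡ 1`
layer's derivative pieces is g0 file 7's mechanism — not here).

THE PRINT (SHAPES and quantifier template only; nothing of [B9] asserted).  [Balaban1985BackgroundPropagators] Thm 3.1 p. 397: *«There exist constants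
M₅, δ₀, α₀ > 0 such that for M ≥ M₅, Mα₀ ≤ a₀ and for arbitrary {Ω_j}, U, B(Λ_j) satisfying … (3.35) … |(G′(U)λ)(x)|, … ≤ B₀[(L^jη)², …]e^{−δ₀d(y,y′)}|λ|»*
(tree `B9.Thm31Printed`; the NE2 shape `T4EtaRate.NE2PlusOperator` copies the quantifier block and inserts King's rate factor).

CONTENTS ([folklore] plumbing + bookkeeping over part A1; 6 defs).
* §1 `coeffBg π M θ : B9.Backgrounds` (the carrier), `reg335_coeffBg_iff`, `blockAvg_zero`; `fineGeo` (the fine realised geometry: `opGeo` with `k + n`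
  scales, spacing `η·L^{−n}`, site scales shifted by `n` — same physical sizes), `bgPairing` (`ι = id`, `τ = pull π`, `avg = blockAvg π`; NOT PRINTED data),
  `bgInstance`, `bgInstance_M` (the fine geometry's size parameter IS the datum's `M`).
* §2 `bgOps` (the four entry operators: entry 0 CONSTRUCTED, entries 1–3 the consumer's), `bgFamily` (`opFamily`), `bgConst` (the explicit output constant).
* §3 **`hasMaj_entry0_background`** (per index, per regular `c′`: entry 0 ≤ `bgConst·θ·e^{−(δ−σ)d}` under the guard `M·α₀ ≤ a₀` with
  `β·c₃₅·a₀·c_r ≤ ½` — A1's `hasMaj_idef_bgProp` with the letters READ OFF `Reg335` and the constant made uniform) and **`etaRateIneq342_background`**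
  (per index: `T4EtaRate.EtaRateIneq342 (bgFamily …) B₀ δ₀ γ c′` with explicit `(B₀, δ₀)` — THE CONTENT, stated per index as ref-B asks).
* §4 **`ne2PlusOperator_background`** — `T4EtaRate.NE2PlusOperator c₃₅ (bgInstance …) (bgFamily …)` for ANY family of such data with UNIFORM letters
  `(β, δ, σ, c_r, m₀, B₃, ρ₃, γ)`: the «+» block is CONSUMED (`Reg335` supplies `r` and `o`; the guard supplies the contraction), `M₅ := 1`,
  `a₀ := (2·c₃₅·(β·c_r + 1))⁻¹`, `B₀ := max(bgConst, B₃) + 1`, `δ₀ := min(δ − σ, ρ₃)`.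

HONEST FRAMING ∕ LIMITS.  Bookkeeping over hypothesis-shaped data: the `U ≡ 1` layer (decaying majorants of `G`, `G′`, their η-defect with the rate number
`θ`, and the entries 1–3 operators) is DISPLAYED, not proved here (inhabited on the unit torus by -a parts 9∕10∕15∕16∕23 — joining them is an instantiation,
not attempted in this file); scalar coefficients and the zeroth-order species only; linearised transport; sites of physical size `≥ 1` (`hlen`; the unit-torus
model) so the (3.42) prefactors are `≥ 1`; the realised geometries keep [B9]'s sites ∕ scales ∕ distance ∕ `M` and leave the Hölder ∕ L² ∕ cut-off sorts
inert (`opGeo`).  The by-name statement of §4 is LIVE exactly when the consumer's family has unbounded `M` (said; the per-index §3 is unconditional content).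
NE2⁺ NOT PRINTED, NOT proved for Bałaban's `G(U)`; count-neutral (typed 28∕28; nothing discharged); N15 NOT discharged; one finite lattice at fixed ε — NOT
infinite volume, NOT OS on ℝ⁴, NOT a mass gap, NOT Clay.
-/

noncomputable section

namespace Summit.QuantumFields.YangMills.BalabanUVNodes.N15.BackgroundLayer

open Literature.MathematicalPhysics.QuantumFieldTheory.Balaban1983to89
open Literature.MathematicalPhysics.QuantumFieldTheory.Balaban1983to89.B11SectG (BlockNorm HasMaj RowSum)
open Literature.MathematicalPhysics.QuantumFieldTheory.Balaban1983to89.T4EtaRate (PairedInstance EtaPairing EtaRateIneq342 NE2PlusOperator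
  rateFactor)
open Literature.MathematicalPhysics.QuantumFieldTheory.Balaban1983to89.T4EtaRateDefect (idef rateWeight)
open Literature.MathematicalPhysics.QuantumFieldTheory.Balaban1983to89.T4EtaRateCoeffDefect (pull pull_apply FibreOsc fibre blockAvg)
open Literature.MathematicalPhysics.QuantumFieldTheory.Balaban1983to89.B6RandomWalk (Triangle254)
open Literature.MathematicalPhysics.QuantumFieldTheory.Balaban1983to89.B9SectDSup (inv_one_sub_le_two)
open Summit.QuantumFields.YangMills.BalabanUVNodes.N15.OperatorReadout (opGeo opFamily opGeo_len rateFactor_opGeo etaRateIneq342_of_hasMaj)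

/-! ## §1 The background carrier, the fine realised geometry, the pairing, the instances -/

section Carrier

variable {X X' : Type}

/-- THE COEFFICIENT BACKGROUND CARRIER over a fine lattice `X′` paired to `X` by `π`, with [B9] size parameter `M` and rate number `θ`: configurations are
coefficient fields `c′ : X′ → ℝ` (the species `V′ = M_{c′}`), `one := 0` (`U ≡ 1 ⟺ A = 0`), `mul := (+)` (abelian model of `U′U`), and `Reg335 c α₀ c′` = THE
(3.35) LETTER PAIR read blockwise: `|c′| ≤ c·M·α₀` and `FibreOsc π c′ (c·M·α₀·θ)`; `Reg336` repeats it (no second-difference letter is consumed by the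
zeroth-order species); the complex classes (3.37)–(3.38) are inert. [cite: Balaban1985BackgroundPropagators, (3.35) p.396 («|A| < O(1)Mα₀(L^jη)^{−1}, |∇^ηA| < O(1)Mα₀(L^jη)^{−2} on □»: shape)] -/
def coeffBg (π : X' → X) (M θ : ℝ) : B9.Backgrounds where
  Cfg := X' → ℝ
  one := 0
  mul := fun c₁ c₂ => c₁ + c₂
  Reg335 := fun c α₀ c' => (∀ x', |c' x'| ≤ c * M * α₀) ∧ FibreOsc π c' (fun _ => c * M * α₀ * θ)
  Reg336 := fun c α₀ c' => (∀ x', |c' x'| ≤ c * M * α₀) ∧ FibreOsc π c' (fun _ => c * M * α₀ * θ)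
  Cplx337 := fun _ _ _ => True
  Cplx338 := fun _ _ _ => True

/-- Unfolding of the carrier's (3.35). [folklore] -/
theorem reg335_coeffBg_iff (π : X' → X) (M θ c α₀ : ℝ) (c' : X' → ℝ) :
    (coeffBg π M θ).Reg335 c α₀ c' ↔ (∀ x', |c' x'| ≤ c * M * α₀) ∧ FibreOsc π c' (fun _ => c * M * α₀ * θ) := Iff.rfl

/-- The block average of the trivial background is trivial (`avg_one`). [folklore] -/
theorem blockAvg_zero [Fintype X'] [DecidableEq X] (π : X' → X) : blockAvg π (0 : X' → ℝ) = 0 := by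
  funext x
  simp [blockAvg]

variable {g : B6.Geometry} [Fintype X] [Fintype X'] [DecidableEq X]

/-- THE FINE REALISED GEOMETRY of a run with `n` more scales on the same blocks: `opGeo` with `k + n` scales, spacing `η·(L^n)⁻¹` and every site's scale
index shifted by `n` — so physical sizes `L^{j+n}η′ = L^jη` agree (`T4EtaRate.EtaPairing.len_ι`). [cite: King1986, p.664 (convention before Prop. 3.8)] -/
@[reducible] def fineGeo (g : B6.Geometry) (X' : Type) [Fintype X'] (blk' : X' → g.Site) (n : ℕ) : B9.Geometry :=
  { opGeo g X' blk' with k := g.k + n, eta := g.eta * (g.L ^ n)⁻¹, scale := fun y => g.scale y + n }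

/-- THE η-PAIRING of the two realised geometries over the coefficient carriers (NOT PRINTED data): scale shift `n`, identity on sites, test functions
pulled back along `π` (cube supports and sup norms preserved), backgrounds transported by the BLOCK AVERAGE. [cite: King1986, p.664 (convention before Prop. 3.8)] -/
def bgPairing (blk : X → g.Site) (π : X' → X) (n : ℕ) (hL : g.L ≠ 0) (θc θ : ℝ) :
    EtaPairing (opGeo g X blk) (fineGeo g X' (blk ∘ π) n) (coeffBg (fun x : X => x) g.M θc) (coeffBg π g.M θ) where
  n := n
  k_eq := rfl
  L_eq := rfl
  M_eq := rfl
  eta_eq := by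
    show g.eta * (g.L ^ n)⁻¹ * g.L ^ n = g.eta
    rw [mul_assoc, inv_mul_cancel₀ (pow_ne_zero _ hL), mul_one]
  ι := fun y => y
  scale_ι := fun _ => rfl
  dist_ι := fun _ _ => rfl
  τ := fun lam => pull π lam
  suppIn_τ := fun _ _ h x' hx' => h (π x') hx'
  supNorm_τ := fun lam => by
    show (⨆ x' : X', |lam (π x')|) ≤ ⨆ x : X, |lam x|
    exact Real.iSup_le (fun x' => abs_le_iSup_abs lam (π x')) (Real.iSup_nonneg fun x => abs_nonneg _)
  avg := fun c' => blockAvg π c'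
  avg_one := blockAvg_zero π

/-- THE REALISED PAIRED INSTANCE of the background layer. [cite: Balaban1985BackgroundPropagators, Thm 3.14 pp.426–427 (typing template)] -/
def bgInstance (blk : X → g.Site) (π : X' → X) (n : ℕ) (hL : g.L ≠ 0) (θc θ : ℝ) : PairedInstance :=
  ⟨opGeo g X blk, fineGeo g X' (blk ∘ π) n, coeffBg (fun x : X => x) g.M θc, coeffBg π g.M θ, bgPairing blk π n hL θc θ⟩

/-- THE GUARD IS LIVE: the fine geometry's [B9] size parameter IS the datum's `M` (not a constant of the construction). [folklore] -/
theorem bgInstance_M (blk : X → g.Site) (π : X' → X) (n : ℕ) (hL : g.L ≠ 0) (θc θ : ℝ) : (bgInstance blk π n hL θc θ).gf.M = g.M := rfl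

end Carrier

/-! ## §2 The four entry operators and the kernel family -/

section Family

variable {X X' : Type} [Fintype X] [Fintype X'] [DecidableEq X] [DecidableEq X'] {g : B6.Geometry}

/-- THE FOUR ENTRY OPERATORS at a fine configuration `c′`: ENTRY 0 = the η-difference of the CONSTRUCTED background-dependent pair (part A1's `bgProp`),
coarse coefficient = the block average; ENTRIES 1–3 (`∇_UG`, `G∇*_U`, `Δ_UG`) SUPPLIED BY THE CONSUMER (`T`). [cite: Balaban1985BackgroundPropagators, (3.42) p.397 (the four entries: shape)] -/
def bgOps (π : X' → X) (G : (X → ℝ) →ₗ[ℝ] (X → ℝ)) (G' : (X' → ℝ) →ₗ[ℝ] (X' → ℝ))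
    (T : Fin 3 → (X' → ℝ) → ((X → ℝ) →ₗ[ℝ] (X' → ℝ))) : Fin 4 → (X' → ℝ) → ((X → ℝ) →ₗ[ℝ] (X' → ℝ)) :=
  fun n c' => ![idef (pull π) (pull π) (bgProp G' c') (bgProp G (blockAvg π c')), T 0 c', T 1 c', T 2 c'] n

/-- THE KERNEL FAMILY of the realised instance (g0's `opFamily`: entry `e n c′ λ y` = sup over the fine cube `y` of `|bgOps n c′ λ|`) over the coefficient
carrier. [cite: Balaban1985BackgroundPropagators, (3.42) p.397 (the four sup entries: shape)] -/
def bgFamily (blk : X → g.Site) (π : X' → X) (n : ℕ) (hL : g.L ≠ 0) (θc θ : ℝ) (G : (X → ℝ) →ₗ[ℝ] (X → ℝ)) (G' : (X' → ℝ) →ₗ[ℝ] (X' → ℝ))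
    (T : Fin 3 → (X' → ℝ) → ((X → ℝ) →ₗ[ℝ] (X' → ℝ))) :
    B9.KernelFamily (bgInstance blk π n hL θc θ).gc (bgInstance blk π n hL θc θ).Bf :=
  show B9.KernelFamily (opGeo g X blk) (coeffBg π g.M θ) from opFamily (g := g) (B := coeffBg π g.M θ) blk (blk ∘ π) (bgOps π G G' T)

/-- THE EXPLICIT OUTPUT CONSTANT of entry 0 (A1's constant with `q ≤ ½`, `r, o∕θ ≤ c₃₅·a₀`): `2·(m₀c_r + m₀c_r·(c₃₅a₀)·2β + β·(c₃₅a₀)·2β·c_r)`. [folklore] -/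
def bgConst (β cr m₀ c35 a₀ : ℝ) : ℝ := (m₀ * cr + m₀ * cr * (c35 * a₀ * (β * 2)) + β * (c35 * a₀) * (β * 2) * cr) * 2

/-- The output constant is non-negative for non-negative letters. [folklore] -/
theorem bgConst_nonneg {β cr m₀ c35 a₀ : ℝ} (hβ : 0 ≤ β) (hcr : 0 ≤ cr) (hm₀ : 0 ≤ m₀) (hc35 : 0 ≤ c35) (ha₀ : 0 ≤ a₀) :
    0 ≤ bgConst β cr m₀ c35 a₀ := by
  unfold bgConst; positivity

end Family

/-! ## §3 Per index: entry 0 of the constructed pair under the guard, and `EtaRateIneq342` with explicit constants -/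

section PerIndex

variable {X X' : Type} [Fintype X] [Fintype X'] [DecidableEq X] [DecidableEq X'] {g : B6.Geometry} (blk : X → g.Site) (π : X' → X)

/-- **ENTRY 0 UNDER THE GUARD, LETTERS READ OFF `Reg335`.**  Data as in A1's `hasMaj_idef_bgProp` (carrier with (2.54), `d ≥ 0`, (2.61) at `σ` with
`c_r ≥ 0`; pieces `G`, `G′ ≤ β·e^{−δd}`, defect `𝔇(G′,G) ≤ m₀·θ·e^{−δd}`, `σ ≤ δ`), a constant `c₃₅ > 0`, a guard `a₀ ≥ 0` with `β·(c₃₅a₀)·c_r ≤ ½`,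
`M ≥ 1`, `α₀ > 0`, `M·α₀ ≤ a₀`, and a configuration `c′` with `(coeffBg π M θ).Reg335 c₃₅ α₀ c′`: then
`𝔇(bgProp G′ c′, bgProp G (blockAvg π c′)) ≤ bgConst(β, c_r, m₀, c₃₅, a₀)·θ·e^{−(δ−σ)d}`. [cite: Balaban1985BackgroundPropagators, Thm 3.1 p.397 (quantifier template: M ≥ M₅, Mα₀ ≤ a₀, (3.35)); (3.63)–(3.65) pp.402–403 (mechanism)] -/
theorem hasMaj_entry0_background (htri : Triangle254 g) (hd : ∀ a b : g.Site, 0 ≤ g.dist a b) {σ cr : ℝ} (hσ : 0 ≤ σ) (hcr : 0 ≤ cr)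
    (hrow : RowSum g σ cr) {δ β m₀ θ c35 a₀ M α₀ : ℝ} (hσδ : σ ≤ δ) (hβ : 0 ≤ β) (hm₀ : 0 ≤ m₀) (hθ : 0 ≤ θ) (hc35 : 0 < c35) (ha₀ : 0 ≤ a₀)
    (hq : β * (c35 * a₀) * cr ≤ 1 / 2) (hM : 1 ≤ M) (hα₀ : 0 < α₀) (hMα : M * α₀ ≤ a₀)
    {G : (X → ℝ) →ₗ[ℝ] (X → ℝ)} {G' : (X' → ℝ) →ₗ[ℝ] (X' → ℝ)}
    (hG : HasMaj (BlockNorm.ofBlocks g blk) (BlockNorm.ofBlocks g blk) G (fun y y' => β * Real.exp (-(δ * g.dist y y'))))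
    (hG' : HasMaj (BlockNorm.ofBlocks g (blk ∘ π)) (BlockNorm.ofBlocks g (blk ∘ π)) G' (fun y y' => β * Real.exp (-(δ * g.dist y y'))))
    (hDG : HasMaj (BlockNorm.ofBlocks g blk) (BlockNorm.ofBlocks g (blk ∘ π)) (idef (pull π) (pull π) G' G)
      (fun y y' => m₀ * θ * Real.exp (-(δ * g.dist y y'))))
    {c' : X' → ℝ} (hreg : (coeffBg π M θ).Reg335 c35 α₀ c') :
    HasMaj (BlockNorm.ofBlocks g blk) (BlockNorm.ofBlocks g (blk ∘ π))
      (idef (pull π) (pull π) (bgProp G' c') (bgProp G (blockAvg π c')))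
      (fun y y' => bgConst β cr m₀ c35 a₀ * θ * Real.exp (-((δ - σ) * g.dist y y'))) := by
  obtain ⟨hsup, hosc⟩ := (reg335_coeffBg_iff π M θ c35 α₀ c').1 hreg
  -- the letters under the guard
  set r : ℝ := c35 * M * α₀ with hr_def
  have hM0 : 0 ≤ M := zero_le_one.trans hM
  have hr0 : 0 ≤ r := by positivity
  have hra : r ≤ c35 * a₀ := by
    rw [hr_def, mul_assoc]
    exact mul_le_mul_of_nonneg_left hMα hc35.le
  have ho0 : 0 ≤ r * θ := mul_nonneg hr0 hθ
  have hq' : β * r * cr ≤ 1 / 2 :=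
    (mul_le_mul_of_nonneg_right (mul_le_mul_of_nonneg_left hra hβ) hcr).trans hq
  have hq1 : β * r * cr < 1 := by linarith
  have hinv : (1 - β * r * cr)⁻¹ ≤ 2 := inv_one_sub_le_two hq'
  have hinv0 : 0 ≤ (1 - β * r * cr)⁻¹ := inv_nonneg.2 (by linarith)
  have hosc' : FibreOsc π c' (fun _ => r * θ) := by
    simpa only [hr_def] using hosc
  -- A1 at the rate ρ = δ − σ
  have key := hasMaj_idef_bgProp blk π htri hd hσ hcr hrow (ρ := δ - σ) (by linarith) (by linarith) hβ hr0 ho0 (mul_nonneg hm₀ hθ)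
    hG hG' hDG hsup hosc' hq1
  refine key.mono fun a b => ?_
  have hE : 0 ≤ Real.exp (-((δ - σ) * g.dist a b)) := Real.exp_nonneg _
  refine mul_le_mul_of_nonneg_right ?_ hE
  rw [one_mul, one_mul]
  -- monotonicity bookkeeping: (1 − q)⁻¹ ≤ 2, r ≤ c₃₅a₀, θ factored out
  have h1 : m₀ * θ * cr * (r * (β * (1 - β * r * cr)⁻¹)) ≤ m₀ * θ * cr * (c35 * a₀ * (β * 2)) :=
    mul_le_mul_of_nonneg_left (mul_le_mul hra (mul_le_mul_of_nonneg_left hinv hβ) (mul_nonneg hβ hinv0) (by positivity)) (by positivity)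
  have h2 : β * (r * θ) * (β * (1 - β * r * cr)⁻¹) * cr ≤ β * (c35 * a₀ * θ) * (β * 2) * cr :=
    mul_le_mul_of_nonneg_right (mul_le_mul (mul_le_mul_of_nonneg_left (mul_le_mul_of_nonneg_right hra hθ) hβ)
      (mul_le_mul_of_nonneg_left hinv hβ) (mul_nonneg hβ hinv0) (by positivity)) hcr
  have hsum0 : 0 ≤ m₀ * θ * cr + m₀ * θ * cr * (c35 * a₀ * (β * 2)) + β * (c35 * a₀ * θ) * (β * 2) * cr := by positivity
  calc (m₀ * θ * cr + m₀ * θ * cr * (r * (β * (1 - β * r * cr)⁻¹)) + β * (r * θ) * (β * (1 - β * r * cr)⁻¹) * cr) * (1 - β * r * cr)⁻¹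
      ≤ (m₀ * θ * cr + m₀ * θ * cr * (c35 * a₀ * (β * 2)) + β * (c35 * a₀ * θ) * (β * 2) * cr) * 2 :=
        mul_le_mul (add_le_add (add_le_add le_rfl h1) h2) hinv hinv0 hsum0
    _ = bgConst β cr m₀ c35 a₀ * θ := by unfold bgConst; ring

/-- The (3.42) prefactors are `≥ 1` at sites of physical size `≥ 1`. [folklore] -/
theorem one_le_pref4 {t : ℝ} (ht : 1 ≤ t) (n : Fin 4) : 1 ≤ B9.pref4 t n := by
  have h2 : 1 ≤ t ^ 2 := by nlinarith
  fin_cases n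
  · simpa [B9.pref4] using h2
  · simpa [B9.pref4] using ht
  · simpa [B9.pref4] using ht
  · simp [B9.pref4]

/-- **`EtaRateIneq342` PER INDEX, EXPLICIT CONSTANTS (the content, stated per index as ref-B READ #323 asks).**  Data of `hasMaj_entry0_background` with
`0 < σ < δ` on a carrier with `η > 0`, `L > 0` and sites of physical size `≥ 1`, a rate exponent `γ` with `θ ≤ (L^{j})^{−γ}` at every site (the instance's rate
number below King's factor), and entries 1–3 operators with majorants `B₃·θ·e^{−ρ₃d}` (`B₃ ≥ 0`, `ρ₃ > 0`): for every configuration `c′` regular in the sense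
of the carrier's (3.35) at `(c₃₅, α₀)` under the guard, the realised kernel family satisfies `T4EtaRate.EtaRateIneq342 … B₀ δ₀ γ c′` with
`B₀ = max(bgConst, B₃)`, `δ₀ = min(δ − σ, ρ₃)`. [cite: Balaban1985BackgroundPropagators, Thm 3.1 (3.42) p.397 (shape)] -/
theorem etaRateIneq342_background (htri : Triangle254 g) (hd : ∀ a b : g.Site, 0 ≤ g.dist a b) {σ cr : ℝ} (hσ : 0 ≤ σ) (hcr : 0 ≤ cr)
    (hrow : RowSum g σ cr) (hη : 0 < g.eta) (hL : 0 < g.L) (hlen : ∀ y, 1 ≤ g.len y) {δ β m₀ θ c35 a₀ M α₀ γ B₃ ρ₃ : ℝ}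
    (hσδ : σ ≤ δ) (hβ : 0 ≤ β) (hm₀ : 0 ≤ m₀) (hθ : 0 ≤ θ) (hθγ : ∀ y, θ ≤ rateWeight g γ y) (hc35 : 0 < c35) (ha₀ : 0 ≤ a₀)
    (hq : β * (c35 * a₀) * cr ≤ 1 / 2) (hM : 1 ≤ M) (hα₀ : 0 < α₀) (hMα : M * α₀ ≤ a₀) (hB₃ : 0 ≤ B₃)
    {G : (X → ℝ) →ₗ[ℝ] (X → ℝ)} {G' : (X' → ℝ) →ₗ[ℝ] (X' → ℝ)} {T : Fin 3 → (X' → ℝ) → ((X → ℝ) →ₗ[ℝ] (X' → ℝ))}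
    (hG : HasMaj (BlockNorm.ofBlocks g blk) (BlockNorm.ofBlocks g blk) G (fun y y' => β * Real.exp (-(δ * g.dist y y'))))
    (hG' : HasMaj (BlockNorm.ofBlocks g (blk ∘ π)) (BlockNorm.ofBlocks g (blk ∘ π)) G' (fun y y' => β * Real.exp (-(δ * g.dist y y'))))
    (hDG : HasMaj (BlockNorm.ofBlocks g blk) (BlockNorm.ofBlocks g (blk ∘ π)) (idef (pull π) (pull π) G' G)
      (fun y y' => m₀ * θ * Real.exp (-(δ * g.dist y y'))))
    {c' : X' → ℝ} (hreg : (coeffBg π M θ).Reg335 c35 α₀ c')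
    (hT : ∀ n : Fin 3, HasMaj (BlockNorm.ofBlocks g blk) (BlockNorm.ofBlocks g (blk ∘ π)) (T n c')
      (fun y y' => B₃ * θ * Real.exp (-(ρ₃ * g.dist y y')))) :
    EtaRateIneq342 (opFamily (g := g) (B := coeffBg π M θ) blk (blk ∘ π) (bgOps π G G' T))
      (max (bgConst β cr m₀ c35 a₀) B₃) (min (δ - σ) ρ₃) γ c' := by
  have h0 := hasMaj_entry0_background blk π htri hd hσ hcr hrow hσδ hβ hm₀ hθ hc35 ha₀ hq hM hα₀ hMα hG hG' hDG hreg
  have hC0 : 0 ≤ bgConst β cr m₀ c35 a₀ := bgConst_nonneg hβ hcr hm₀ hc35.le ha₀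
  have hB₀ : 0 ≤ max (bgConst β cr m₀ c35 a₀) B₃ := hC0.trans (le_max_left _ _)
  refine etaRateIneq342_of_hasMaj (g := g) (B := coeffBg π M θ) blk (blk ∘ π) hη.le hL.le hB₀ (bgOps π G G' T) c' fun n => ?_
  -- the common domination: `B·θ·e^{−ρd} ≤ B₀·pref4·e^{−δ₀d}·max(rf y, rf y′)` for `B ≤ B₀`, `δ₀ ≤ ρ`
  have hdom : ∀ {B ρ : ℝ}, 0 ≤ B → B ≤ max (bgConst β cr m₀ c35 a₀) B₃ → min (δ - σ) ρ₃ ≤ ρ → ∀ y y' : g.Site,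
      B * θ * Real.exp (-(ρ * g.dist y y')) ≤
        max (bgConst β cr m₀ c35 a₀) B₃ * B9.pref4 ((opGeo g X blk).len y) n * Real.exp (-(min (δ - σ) ρ₃ * g.dist y y')) *
          max (rateFactor (opGeo g X blk) γ y) (rateFactor (opGeo g X blk) γ y') := by
    intro B ρ hB0 hB hρ y y'
    have hpref : 1 ≤ B9.pref4 ((opGeo g X blk).len y) n := by rw [opGeo_len]; exact one_le_pref4 (hlen y) n
    have hexp : Real.exp (-(ρ * g.dist y y')) ≤ Real.exp (-(min (δ - σ) ρ₃ * g.dist y y')) :=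
      Real.exp_le_exp.mpr (neg_le_neg (mul_le_mul_of_nonneg_right hρ (hd y y')))
    have hrf : θ ≤ max (rateFactor (opGeo g X blk) γ y) (rateFactor (opGeo g X blk) γ y') := by
      rw [rateFactor_opGeo g X blk hη.ne' hL γ y']
      exact (hθγ y').trans (le_max_right _ _)
    have hE : 0 ≤ Real.exp (-(min (δ - σ) ρ₃ * g.dist y y')) := Real.exp_nonneg _
    calc B * θ * Real.exp (-(ρ * g.dist y y'))
        ≤ (max (bgConst β cr m₀ c35 a₀) B₃ * B9.pref4 ((opGeo g X blk).len y) n) * θ * Real.exp (-(min (δ - σ) ρ₃ * g.dist y y')) := by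
          refine mul_le_mul (mul_le_mul_of_nonneg_right ?_ hθ) hexp (Real.exp_nonneg _) (mul_nonneg (mul_nonneg hB₀ (zero_le_one.trans hpref)) hθ)
          calc B = B * 1 := (mul_one B).symm
            _ ≤ max (bgConst β cr m₀ c35 a₀) B₃ * B9.pref4 ((opGeo g X blk).len y) n := mul_le_mul hB hpref zero_le_one hB₀
      _ = max (bgConst β cr m₀ c35 a₀) B₃ * B9.pref4 ((opGeo g X blk).len y) n * Real.exp (-(min (δ - σ) ρ₃ * g.dist y y')) * θ := by ring
      _ ≤ _ := mul_le_mul_of_nonneg_left hrf (mul_nonneg (mul_nonneg hB₀ (zero_le_one.trans hpref)) hE)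
  fin_cases n
  · exact h0.mono (hdom hC0 (le_max_left _ _) (min_le_left _ _))
  · exact (hT 0).mono (hdom hB₃ (le_max_right _ _) (min_le_right _ _))
  · exact (hT 1).mono (hdom hB₃ (le_max_right _ _) (min_le_right _ _))
  · exact (hT 2).mono (hdom hB₃ (le_max_right _ _) (min_le_right _ _))

end PerIndex

/-! ## §4 The node's first conjunct BY NAME, background block LIVE -/

section Node

variable {I : Type} (g : I → B6.Geometry) (X X' : I → Type) [∀ i, Fintype (X i)] [∀ i, Fintype (X' i)] [∀ i, DecidableEq (X i)]
  [∀ i, DecidableEq (X' i)] (blk : ∀ i, X i → (g i).Site) (π : ∀ i, X' i → X i) (nsh : I → ℕ) (hL0 : ∀ i, (g i).L ≠ 0) (θc θ : I → ℝ)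
  (G : ∀ i, (X i → ℝ) →ₗ[ℝ] (X i → ℝ)) (G' : ∀ i, (X' i → ℝ) →ₗ[ℝ] (X' i → ℝ)) (T : ∀ i, Fin 3 → (X' i → ℝ) → ((X i → ℝ) →ₗ[ℝ] (X' i → ℝ)))

/-- **NE2⁺, OPERATOR LAYER — THE NODE'S FIRST CONJUNCT `T4EtaRate.NE2PlusOperator` BY NAME, BACKGROUND BLOCK LIVE.**  For ANY family of data — [B6]
carriers with (2.54), `d ≥ 0`, a UNIFORM (2.61) row sum `(σ, c_r)`, `η, L > 0`, sites of physical size `≥ 1`; coarse∕fine lattices blocked and paired;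
`U ≡ 1` pieces `G_i`, `G′_i` with UNIFORM decaying majorants `β·e^{−δd}` (`σ < δ`) and UNIFORM η-defect `𝔇(G′_i, G_i) ≤ m₀·θ_i·e^{−δd}` with the instance's rate
number `0 ≤ θ_i ≤ (L^j)^{−γ}` (`γ > 0`); entries 1–3 operators with UNIFORM majorants `B₃·θ_i·e^{−ρ₃d}` (`ρ₃ > 0`) at every configuration — and a constant
`c₃₅ > 0`: the realised paired instances over the coefficient carriers (size parameter = the datum's `M`, `bgInstance_M`) and their kernel families
(entry 0 = the CONSTRUCTED background-dependent pair) satisfy `NE2PlusOperator c₃₅`, with `M₅ = 1`, `a₀ = (2·c₃₅·(β·c_r + 1))⁻¹`,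
`B₀ = max(bgConst, B₃) + 1`, `δ₀ = min(δ − σ, ρ₃)`, rate exponent `γ` — the regularity hypothesis (3.35) is CONSUMED (it supplies the sup and oscillation letters;
the guard `M·α₀ ≤ a₀` supplies the Neumann contraction). [cite: Balaban1985BackgroundPropagators, Thm 3.1 p.397 (quantifier template); (3.35) p.396, (3.63)–(3.65) pp.402–403 (shapes, mechanism)] -/
theorem ne2PlusOperator_background (c35 : ℝ) (hc35 : 0 < c35)
    (htri : ∀ i, Triangle254 (g i)) (hd : ∀ i (a b : (g i).Site), 0 ≤ (g i).dist a b) {σ cr : ℝ} (hσ : 0 ≤ σ) (hcr : 0 ≤ cr)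
    (hrow : ∀ i, RowSum (g i) σ cr) (hη : ∀ i, 0 < (g i).eta) (hL : ∀ i, 0 < (g i).L) (hlen : ∀ i y, 1 ≤ (g i).len y)
    {δ β m₀ γ B₃ ρ₃ : ℝ} (hσδ : σ < δ) (hβ : 0 ≤ β) (hm₀ : 0 ≤ m₀) (hγ : 0 < γ) (hθ : ∀ i, 0 ≤ θ i)
    (hθγ : ∀ i y, θ i ≤ rateWeight (g i) γ y) (hB₃ : 0 ≤ B₃) (hρ₃ : 0 < ρ₃)
    (hG : ∀ i, HasMaj (BlockNorm.ofBlocks (g i) (blk i)) (BlockNorm.ofBlocks (g i) (blk i)) (G i)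
      (fun y y' => β * Real.exp (-(δ * (g i).dist y y'))))
    (hG' : ∀ i, HasMaj (BlockNorm.ofBlocks (g i) (blk i ∘ π i)) (BlockNorm.ofBlocks (g i) (blk i ∘ π i)) (G' i)
      (fun y y' => β * Real.exp (-(δ * (g i).dist y y'))))
    (hDG : ∀ i, HasMaj (BlockNorm.ofBlocks (g i) (blk i)) (BlockNorm.ofBlocks (g i) (blk i ∘ π i)) (idef (pull (π i)) (pull (π i)) (G' i) (G i))
      (fun y y' => m₀ * θ i * Real.exp (-(δ * (g i).dist y y'))))
    (hT : ∀ i (c' : X' i → ℝ) (n : Fin 3), HasMaj (BlockNorm.ofBlocks (g i) (blk i)) (BlockNorm.ofBlocks (g i) (blk i ∘ π i)) (T i n c')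
      (fun y y' => B₃ * θ i * Real.exp (-(ρ₃ * (g i).dist y y')))) :
    NE2PlusOperator c35 (fun i => bgInstance (blk i) (π i) (nsh i) (hL0 i) (θc i) (θ i))
      (fun i => bgFamily (blk i) (π i) (nsh i) (hL0 i) (θc i) (θ i) (G i) (G' i) (T i)) := by
  -- the guard constant: `β·(c₃₅a₀)·c_r ≤ ½`
  set a₀ : ℝ := (2 * c35 * (β * cr + 1))⁻¹ with ha₀_def
  have hden : 0 < 2 * c35 * (β * cr + 1) := by positivity
  have ha₀ : 0 < a₀ := inv_pos.2 hden
  have hq : β * (c35 * a₀) * cr ≤ 1 / 2 := by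
    have h1 : β * (c35 * a₀) * cr = (β * cr) * (c35 * a₀) := by ring
    have h2 : c35 * a₀ = (2 * (β * cr + 1))⁻¹ := by
      rw [ha₀_def]; field_simp
    rw [h1, h2, ← div_eq_mul_inv, div_le_iff₀ (by positivity)]
    nlinarith [mul_nonneg hβ hcr]
  have hC0 : 0 ≤ bgConst β cr m₀ c35 a₀ := bgConst_nonneg hβ hcr hm₀ hc35.le ha₀.le
  refine ⟨1, min (δ - σ) ρ₃, a₀, max (bgConst β cr m₀ c35 a₀) B₃ + 1, γ, one_pos, lt_min (by linarith) hρ₃, ha₀,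
    lt_of_lt_of_le one_pos (le_add_of_nonneg_left (hC0.trans (le_max_left _ _))), hγ, fun i hM α₀ hα₀ hMα c' hreg => ?_⟩
  have hM' : 1 ≤ (g i).M := hM
  have hMα' : (g i).M * α₀ ≤ a₀ := hMα
  have key := etaRateIneq342_background (blk i) (π i) (htri i) (hd i) hσ hcr (hrow i) (hη i) (hL i) (hlen i) hσδ.le hβ hm₀ (hθ i) (hθγ i)
    hc35 ha₀.le hq hM' hα₀ hMα' hB₃ (hG i) (hG' i) (hDG i) hreg (hT i c')
  -- `EtaRateIneq342` is monotone in `B₀` (here `B₀ ↦ B₀ + 1`, to display a strictly positive constant)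
  intro n lam y y' hs
  refine (key n lam y y' hs).trans ?_
  have hpref : 0 ≤ B9.pref4 ((bgInstance (blk i) (π i) (nsh i) (hL0 i) (θc i) (θ i)).gc.len y) n := by
    have : 1 ≤ B9.pref4 ((opGeo (g i) (X i) (blk i)).len y) n := by rw [opGeo_len]; exact one_le_pref4 (hlen i y) n
    exact zero_le_one.trans this
  have hrf : 0 ≤ max (rateFactor (bgInstance (blk i) (π i) (nsh i) (hL0 i) (θc i) (θ i)).gc γ y)
      (rateFactor (bgInstance (blk i) (π i) (nsh i) (hL0 i) (θc i) (θ i)).gc γ y') :=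
    (T4EtaRate.rateFactor_nonneg (g := opGeo (g i) (X i) (blk i)) (hη i).le (hL i).le γ y).trans (le_max_left _ _)
  have hnorm : 0 ≤ (bgInstance (blk i) (π i) (nsh i) (hL0 i) (θc i) (θ i)).gc.supNorm lam :=
    Real.iSup_nonneg fun x => abs_nonneg _
  have hE : 0 ≤ Real.exp (-(min (δ - σ) ρ₃ * (bgInstance (blk i) (π i) (nsh i) (hL0 i) (θc i) (θ i)).gc.dist y y')) := Real.exp_nonneg _
  exact mul_le_mul_of_nonneg_right (mul_le_mul_of_nonneg_right (mul_le_mul_of_nonneg_right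
    (mul_le_mul_of_nonneg_right (le_add_of_nonneg_right zero_le_one) hpref) hE) hrf) hnorm

end Node

end Summit.QuantumFields.YangMills.BalabanUVNodes.N15.BackgroundLayer
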